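import Mathlib
import Summits.Ventures.PercRepro2.Defs
import Summits.Ventures.PercRepro2.Graph
import Summits.Ventures.PercRepro2.OneColourSwitch
import Summits.Ventures.PercRepro2.RegionHubSign
import Summits.Ventures.PercRepro2.SideSwitch
import Summits.Ventures.PercRepro2.SideSwitchFibre
import Summits.Ventures.PercRepro2.SideSwitchClosed
import Summits.Ventures.PercRepro2.SideSwitchComps
import Summits.Ventures.PercRepro2.SideSwitchCompsFibre
import Summits.Ventures.PercRepro2.M9NoPocketDefs
import Summits.Ventures.PercRepro2.M9NoPocketWorld
import Summits.Ventures.PercRepro2.M9NoPocketWorldD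
import Summits.Ventures.PercRepro2.M9NoPocketCompl
import Summits.Ventures.PercRepro2.M9DAvoid
import Summits.Ventures.PercRepro2.M9DAvoidSplit
import Summits.Ventures.PercRepro2.M9RegionSplit
import Summits.Ventures.PercRepro2.M9HarrisCube
import Summits.Ventures.PercRepro2.M9PocketCubeDefs
import Summits.Ventures.PercRepro2.M9PocketCubeFibre
import Summits.Ventures.PercRepro2.M9PocketCubeMono
import Summits.Ventures.PercRepro2.M9PocketCubeHub
import Summits.Ventures.PercRepro2.M9PocketCubeWorldMono
import Summits.Ventures.PercRepro2.M9PocketCubeCompl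
import Summits.Ventures.PercRepro2.M9PocketCubeHarrisY
import Summits.Ventures.PercRepro2.M9SingleDPocket
import Summits.Ventures.PercRepro2.M9DeadEnd
import Summits.Ventures.PercRepro2.M9DeadEndMono
import Summits.Ventures.PercRepro2.M9DeadEndHarris
import Summits.Ventures.PercRepro2.M9Trichotomy

/-!
# The one-sided sum is non-positive: a down-set of the pocket cube (blind cell PercRepro2,
p3 g24, 2026-08-28; `proofs/P3-CONJG.md` §3)

On the cube of a pocket representative the region `regS` — legal vectors with `d ∉ M₂`, no
`Y`-hub and `r ≁_W s` in `G − d` — is a **down-set** (`regS_lower`: the proof of `regA1_lower`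
with its hub-or-dead-end clause dropped), so the tilt lemma of `M9HarrisCube` gives
`Σ_{regS} σ̃_pq ≤ 0` (`regS_sum_nonpos`).  A `Sep`-colouring with `d ∉ M₂` and an edge `d–r` has
no `Y`-hub (`not_hubY_of_sep2_of_not_mem_M2`), so the fibration sums this to the one-sided sum
of `M9Trichotomy`: `sOneSum ≤ 0` (`sOneSum_nonpos`).  Own work; std axioms.
-/

namespace Summit.Ventures.PercRepro2

namespace NoPocket

open Finset Classical RegionHub OneColourSwitch SideSwitch TermSwitch

variable {V : Type*} {E : Type*}

section Hub

variable {ends : E → Sym2 V}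

/-- A `Sep`-colouring with `d ∉ M₂` and an edge `d–r` has no `Y`-hub edge: a `Y`-hub would join
`p` or `q` to `r` through `d`. -/
lemma not_hubY_of_sep2_of_not_mem_M2 {p q r s d : V} {ω : Config E}
    (hsep : sep2 ends p q r s ω) (hM : d ∉ M2 ends r s ω) {er : E} (her : ends er = s(d, r)) :
    ¬ hubY ends d p q ω := by
  intro hY
  have hdr : Conn ends ω d r := conn_of_edge_of_not_mem_M2 hM (Or.inl rfl) her
  obtain ⟨⟨hpr, _, hqr, _⟩, _⟩ := hsep
  rcases conn_d_of_hubY hY with h | h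
  · exact hpr (conn_trans (conn_symm h) hdr)
  · exact hqr (conn_trans (conn_symm h) hdr)

end Hub

section Region

variable [Fintype V] [DecidableEq V] [Fintype E] [DecidableEq E]

variable (ends : E → Sym2 V)

/-- The one-sided region of a representative: legal vectors with `d ∉ M₂`, no `Y`-hub and
`r ≁_W s` in `G − d`. -/
noncomputable def regS (p q r s d : V) (ρ : Config E) : Finset (Finset (Finset V) × Finset E) :=
  (cubeP ends d r s ρ).filter (fun x => assignX ends x ρ ∈ DOneSet ends p q r s d ∧
    d ∉ M2 ends r s (assignX ends x ρ) ∧ ¬ hubY ends d p q (assignX ends x ρ) ∧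
    ¬ Conn (endsD ends d) (OneColourSwitch.compl (assignX ends x ρ)) r s)

variable {ends}

/-- Membership in the one-sided region. -/
lemma mem_regS {p q r s d : V} {ρ : Config E} {x : Finset (Finset V) × Finset E} :
    x ∈ regS ends p q r s d ρ ↔ x ∈ cubeP ends d r s ρ ∧
      (assignX ends x ρ ∈ DOneSet ends p q r s d ∧ d ∉ M2 ends r s (assignX ends x ρ) ∧
        ¬ hubY ends d p q (assignX ends x ρ) ∧
        ¬ Conn (endsD ends d) (OneColourSwitch.compl (assignX ends x ρ)) r s) := by
  simp [regS]

/-- **The one-sided region is a down-set of the cube.** -/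
theorem regS_lower {p q r s d : V} (hr : d ≠ r) (hs : d ≠ s) (hpd : p ≠ d) (hqd : q ≠ d)
    {er : E} (her : ends er = s(d, r)) {ρ : Config E} (hρ : ρ ∈ RepP ends p q r s d)
    {x x' : Finset (Finset V) × Finset E} (hxx' : x' ≤ x) (hx' : x' ∈ cubeP ends d r s ρ)
    (hx : x ∈ regS ends p q r s d ρ) : x' ∈ regS ends p q r s d ρ := by
  obtain ⟨hρD, _⟩ := mem_RepP.1 hρ
  obtain ⟨hxc, hxD, hM, hY, hrs⟩ := mem_regS.1 hx
  obtain ⟨_, hD⟩ := mem_DOneSet.1 hxD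
  obtain ⟨hT', hF'⟩ := mem_cubeP.1 hx'
  have hM' : d ∉ M2 ends r s (assignX ends x' ρ) :=
    fun h' => hM (mem_M2_assignX_mono hr hs hρ hxx' hx' hxc h')
  have hY' : ¬ hubY ends d p q (assignX ends x' ρ) :=
    fun h' => hY (hubY_assignX_mono hr hs hpd hqd hρ hxx' hx' hxc h')
  have hrs' : ¬ Conn (endsD ends d) (OneColourSwitch.compl (assignX ends x' ρ)) r s :=
    fun h' => hrs (conn_endsD_compl_assignX_mono_of_mem_M2 hr hs hρD hxx' hx' hxc
      (r_mem_M2 _ _ _) h')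
  have hsep' : sep2 ends p q r s (assignX ends x' ρ) :=
    sep2_of_not_mem_M2_of_not_hubY hpd hqd (sep2_endsD_assignX' hr hs hρD hT' hF') hM' hY'
  have hD' : DOne ends r s d (assignX ends x' ρ) :=
    DOne_assignX_anti_of_not_mem_M2 hr hs hρ hxx' hxc hx' her hM hD
  exact mem_regS.2 ⟨hx', mem_DOneSet.2 ⟨hsep', hD'⟩, hM', hY', hrs'⟩

/-- **Harris for the one-sided region**: `Σ_{regS} σ̃_pq ≤ 0` for every pocket representative. -/
theorem regS_sum_nonpos {p q r s d : V} (hr : d ≠ r) (hs : d ≠ s) (hpd : p ≠ d) (hqd : q ≠ d)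
    {er : E} (her : ends er = s(d, r)) {ρ : Config E} (hρ : ρ ∈ RepP ends p q r s d) :
    ∑ x ∈ regS ends p q r s d ρ, sigma (endsD ends d) (assignX ends x ρ) p q ≤ 0 := by
  obtain ⟨hρD, _⟩ := mem_RepP.1 hρ
  set c : Finset (Finset V) × Finset E := (blocks ends d r s ρ, freeE ends d r s ρ) with hc
  have hcube : HarrisCube.cube c = cubeP ends d r s ρ := cube_eq_cubeP ρ
  have hle : ∀ x, x ≤ c ↔ x ∈ cubeP ends d r s ρ := fun x => by
    rw [← HarrisCube.mem_cube, hcube]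
  have hκc : ∀ x, x ≤ c → cdualP ends d r s ρ x ≤ c := fun x _ => (hle _).2 (cdualP_mem_cubeP ρ x)
  have hκκ : ∀ x, x ≤ c → cdualP ends d r s ρ (cdualP ends d r s ρ x) = x :=
    fun x hx => cdualP_cdualP ((hle x).1 hx)
  -- the tilt lemma with `h = 1 − 1[regS]` (monotone, the region being a down-set)
  have key := HarrisCube.sum_sub_comp_mul_nonneg c (κ := cdualP ends d r s ρ) hκc hκκ
    (fun x _ y _ hxy => cdualP_antitone ρ hxy) (f := yInd ends p q d ρ)
    (h := fun x => 1 - (if x ∈ regS ends p q r s d ρ then 1 else 0))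
    (fun x _ => yInd_nonneg ρ x) (fun x _ => by split_ifs <;> norm_num) ?_ ?_
  · rw [hcube] at key
    -- Σ (f − f∘κ) = 0
    have hzero : ∑ x ∈ cubeP ends d r s ρ,
        (yInd ends p q d ρ x - yInd ends p q d ρ (cdualP ends d r s ρ x)) = 0 := by
      rw [Finset.sum_sub_distrib, ← hcube, HarrisCube.sum_comp_involution c hκc hκκ, sub_self]
    have hsub : regS ends p q r s d ρ ⊆ cubeP ends d r s ρ := Finset.filter_subset _ _
    have hsplit : ∑ x ∈ cubeP ends d r s ρ,
        (yInd ends p q d ρ x - yInd ends p q d ρ (cdualP ends d r s ρ x)) *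
          (1 - (if x ∈ regS ends p q r s d ρ then 1 else 0)) =
        ∑ x ∈ cubeP ends d r s ρ,
          (yInd ends p q d ρ x - yInd ends p q d ρ (cdualP ends d r s ρ x)) -
        ∑ x ∈ regS ends p q r s d ρ,
          (yInd ends p q d ρ x - yInd ends p q d ρ (cdualP ends d r s ρ x)) := by
      rw [show (∑ x ∈ cubeP ends d r s ρ,
          (yInd ends p q d ρ x - yInd ends p q d ρ (cdualP ends d r s ρ x)) *
            (1 - (if x ∈ regS ends p q r s d ρ then 1 else 0))) =
          ∑ x ∈ cubeP ends d r s ρ,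
            ((yInd ends p q d ρ x - yInd ends p q d ρ (cdualP ends d r s ρ x)) -
              (if x ∈ regS ends p q r s d ρ then
                yInd ends p q d ρ x - yInd ends p q d ρ (cdualP ends d r s ρ x) else 0)) from
        Finset.sum_congr rfl fun x _ => by split_ifs <;> ring]
      rw [Finset.sum_sub_distrib, Finset.sum_ite_mem, Finset.inter_eq_right.2 hsub]
    rw [hsplit, hzero, zero_sub, neg_nonneg] at key
    refine le_of_eq_of_le ?_ key
    refine Finset.sum_congr rfl fun x hx => ?_
    exact sigma_endsD_eq_sub_cdualP hr hs hρD (Finset.mem_filter.1 hx).1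
  · intro x hx y hy hxy
    have hx' := (hle x).1 hx
    have hy' := (hle y).1 hy
    obtain ⟨hT, hF⟩ := mem_cubeP.1 hx'
    simp only [yInd]
    by_cases h1 : Conn (endsD ends d) (assignX ends x ρ) p q
    · have h2 : Conn (endsD ends d) (assignX ends y ρ) p q :=
        conn_endsD_assignX_mono hr hs hρ hxy hx' hy'
          (not_mem_K2_of_sep2 (sep2_endsD_assignX' hr hs hρD hT hF)).1 h1
      simp [h1, h2]
    · simp only [h1, if_false]
      split_ifs <;> norm_num
  · intro x hx y hy hxy
    dsimp only
    by_cases h2 : y ∈ regS ends p q r s d ρ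
    · have h1 : x ∈ regS ends p q r s d ρ := regS_lower hr hs hpd hqd her hρ hxy ((hle x).1 hx) h2
      simp [h1, h2]
    · simp only [h2, if_false]
      split_ifs <;> norm_num

/-- **`sOneSum ≤ 0`** with an edge `d–r`. -/
theorem sOneSum_nonpos {p q r s d : V} (hr : d ≠ r) (hs : d ≠ s) (hpd : p ≠ d) (hqd : q ≠ d)
    {er : E} (her : ends er = s(d, r)) : sOneSum ends p q r s d ≤ 0 := by
  have h1 : sOneSum ends p q r s d = ∑ ω ∈ DOneSet ends p q r s d,
      (if d ∉ M2 ends r s ω ∧ ¬ hubY ends d p q ω ∧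
          ¬ Conn (endsD ends d) (OneColourSwitch.compl ω) r s then
        sigma (endsD ends d) ω p q else 0) := by
    unfold sOneSum DOneSet
    rw [Finset.sum_filter]
    refine Finset.sum_congr rfl fun ω _ => ?_
    by_cases h : sep2 ends p q r s ω ∧ DOne ends r s d ω
    · rw [if_pos h]
      by_cases hM : d ∉ M2 ends r s ω
      · have hY : ¬ hubY ends d p q ω := not_hubY_of_sep2_of_not_mem_M2 h.1 hM her
        by_cases hc : Conn (endsD ends d) (OneColourSwitch.compl ω) r s
        · have ha : ¬ (sep2 ends p q r s ω ∧ DOne ends r s d ω ∧ d ∉ M2 ends r s ω ∧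
              ¬ Conn (endsD ends d) (OneColourSwitch.compl ω) r s) := fun h' => h'.2.2.2 hc
          have hb : ¬ (d ∉ M2 ends r s ω ∧ ¬ hubY ends d p q ω ∧
              ¬ Conn (endsD ends d) (OneColourSwitch.compl ω) r s) := fun h' => h'.2.2 hc
          rw [if_neg ha, if_neg hb]
        · have ha : sep2 ends p q r s ω ∧ DOne ends r s d ω ∧ d ∉ M2 ends r s ω ∧
              ¬ Conn (endsD ends d) (OneColourSwitch.compl ω) r s := ⟨h.1, h.2, hM, hc⟩
          have hb : d ∉ M2 ends r s ω ∧ ¬ hubY ends d p q ω ∧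
              ¬ Conn (endsD ends d) (OneColourSwitch.compl ω) r s := ⟨hM, hY, hc⟩
          rw [if_pos ha, if_pos hb]
      · have ha : ¬ (sep2 ends p q r s ω ∧ DOne ends r s d ω ∧ d ∉ M2 ends r s ω ∧
            ¬ Conn (endsD ends d) (OneColourSwitch.compl ω) r s) := fun h' => hM h'.2.2.1
        have hb : ¬ (d ∉ M2 ends r s ω ∧ ¬ hubY ends d p q ω ∧
            ¬ Conn (endsD ends d) (OneColourSwitch.compl ω) r s) := fun h' => hM h'.1
        rw [if_neg ha, if_neg hb]
    · have ha : ¬ (sep2 ends p q r s ω ∧ DOne ends r s d ω ∧ d ∉ M2 ends r s ω ∧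
          ¬ Conn (endsD ends d) (OneColourSwitch.compl ω) r s) := fun h' => h ⟨h'.1, h'.2.1⟩
      rw [if_neg ha, if_neg h]
  rw [h1, sum_dOne_eq_sum_repP_legalP hr hs]
  refine Finset.sum_nonpos fun ρ hρ => ?_
  have h2 : ∑ x ∈ LegalP ends p q r s d ρ,
      (if d ∉ M2 ends r s (assignX ends x ρ) ∧ ¬ hubY ends d p q (assignX ends x ρ) ∧
          ¬ Conn (endsD ends d) (OneColourSwitch.compl (assignX ends x ρ)) r s then
        sigma (endsD ends d) (assignX ends x ρ) p q else 0) =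
      ∑ x ∈ regS ends p q r s d ρ, sigma (endsD ends d) (assignX ends x ρ) p q := by
    rw [← Finset.sum_filter]
    refine Finset.sum_congr ?_ fun _ _ => rfl
    ext x
    simp only [Finset.mem_filter, mem_LegalP, mem_regS]
    tauto
  rw [h2]
  exact regS_sum_nonpos hr hs hpd hqd her hρ

end Region

end NoPocket

end Summit.Ventures.PercRepro2
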